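import Summits.HodgeConjecture.HodgeConjecture.Theses.DworkReflectionQuotients
import Literature.AlgebraicGeometry.HodgeTheory.DworkSexticSingletonPurity
import Literature.AlgebraicGeometry.HodgeTheory.DworkSexticSingletonRankOfTransport

/-!
# Crux K2 `FlatClassesSpannedByReflectionInvariants` for the singleton flat type `(1,2,3,3,4,5)`,
# modulo a `Γ_W`-equivariant transport to the Fermat point (no Hodge-theoretic named fact)

Route `route-HodgeConjecture-DworkReflectionQuotients` (cell `hodge-nonav`, rung F-H1 — never summit
credit), item `stmt-HodgeConjecture-20241`; landed `--supports stmt-HodgeConjecture-20241` (it serves the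
item without closing it: it is the `j = 0` instance of the crux — Katz's rank-one type, 360 of the
1170 flat classes — and it is CONDITIONAL on an explicit topological hypothesis). Prover seat
`hodge-nonav-20241-p1` (g2), 2026-08-27.

The two existing Summits files for this item (`DworkReflectionQuotientsK2ModuloKatz`,
`DworkReflectionQuotientsK2OfGriffiths`) obtain the whole crux from a Hodge-theoretic named fact
(`Katz2009_dworkSexticEigenspaces`, resp. `Griffiths1969_residues_span_hodgeFiltration`), the
`(2,2)`-ness of the flat eigenclasses being the entire content. For the SINGLETON type the Literature
theorems `DworkSextic.flatClasses_mem_span_reflInvariant_singleton_of_rank_le_one` (purity from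
symmetry: `conj` followed by the coordinate reversal maps `V_e ∩ H^{p,q}` into `V_e ∩ H^{q,p}` in one
Hodge model, so a rank-one `V_e` is of type `(2,2)`) and
`DworkSextic.singleton_rank_le_one_of_equivariant_transport` (rank one at `ψ` from rank one at the
Fermat point — the tree's `fermatEigenspace_le_span_of_ne_zero`, `fermatEigenspace_eq_bot_of_apply_eq_zero`
— through an equivariant injective linear map) replace that input by the hypothesis

  `hT`: for every `ψ` with `ψ⁶ ≠ 1` there is an injective `ℂ`-linear map
  `T : H⁴(X_ψ(ℂ); ℂ) → H⁴(X⁴₆(ℂ); ℂ)` intertwining the diagonal symmetries `g_a`, `a ∈ Γ_W`,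

which is what parallel transport in `R⁴π_*ℂ` along a path from `ψ` to `0` in `ℂ ∖ μ₆` provides
(Ehresmann, Voisin I Thm. 9.3 / §9.2.1; `Γ_W` acts on the Dwork family over the base, Katz 2009 §3, and
transport commutes with endomorphisms over the base, Voisin II §3.1.2 — in the tree for the universal
family of sextics: `universalHypersurfaceLocalSystemOfEhresmann`, `transportFun_map_fiberHom`; the
`Γ_W`-action on a family containing the Dwork line is the missing construction). No named fact enters.

## References

* N. M. Katz, *Another look at the Dwork family*, Progr. Math. 270 (2009), §3, Lemma 3.1. [Katz2009]
* C. Voisin, *Hodge Theory and Complex Algebraic Geometry I* (2002), Cor. 6.12, §7.3.2, Thm. 9.3,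
  §9.2.1. [VoisinHodgeI2002]
* G. Bini, A. Garbagnati, *Quotients of the Dwork pencil*, J. Geom. Phys. 75 (2014), §3.4.
  [BiniGarbagnati2012]
-/

namespace Summit.HodgeConjecture.HodgeConjecture.Theorems

open Literature.AlgebraicGeometry.HodgeTheory Literature.AlgebraicGeometry.Motives
open Literature.AlgebraicTopology.SingularHomology

/-- **Crux K2 for the singleton type, modulo an equivariant transport to the Fermat point.** Granted,
for every `ψ` with `ψ⁶ ≠ 1`, an injective `ℂ`-linear `T : H⁴(X_ψ(ℂ); ℂ) → H⁴(X⁴₆(ℂ); ℂ)` with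
`T ∘ g_a^* = g_a^* ∘ T` for all `a ∈ Γ_W` (parallel transport along the Dwork line): for `ψ⁶ ≠ 1`,
`σ ∈ 𝔖₆` and every rational class `w = u + v` with `u` an eigenclass of exponent `(1,2,3,3,4,5) ∘ σ`
and `v` one of exponent `(6 − (1,2,3,3,4,5)) ∘ σ`, the class `w` lies in the `ℂ`-span of the rational
`(2,2)`-classes fixed by a realised reflection `s_(i,i',ζ)` — the `j = 0` instance of
`FlatClassesSpannedByReflectionInvariants` (`X_ψ = DworkSextic.fibre ψ`, `IsEig = DworkSextic.IsEig ψ`,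
`pt = DworkSextic.pt ψ`, `(1,2,3,3,4,5) = DworkSextic.flatTypes 0` are the route's inline objects). One
application of the two Literature theorems; CONDITIONAL on `hT` only (no named fact).
[cite: Katz2009, Lemma 3.1] [cite: VoisinHodgeI2002, §9.2.1 and §7.3.2] -/
theorem flatClassesSpannedByReflectionInvariants_singleton_of_transport
    (hT : ∀ ψ : ℂ, ψ ^ 6 ≠ 1 →
      ∃ T : complexBetti (DworkSextic.fibre ψ) (2 * 2) →ₗ[ℂ] complexBetti (fermatHypersurface 4 6) (2 * 2),
        Function.Injective T ∧
        ∀ (a : DworkSextic.gammaW) (c : complexBetti (DworkSextic.fibre ψ) (2 * 2)),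
          T (singularCohomology.map ℂ ℂ
              (diagonalMap (DworkSextic.form ψ) (DworkSextic.gammaW_le_diagonalStabilizer ψ a.2)) (2 * 2) c) =
            singularCohomology.map ℂ ℂ
              (diagonalMap (fermatPolynomial ℂ 4 6) (DworkSextic.gammaW_le_diagonalStabilizer_fermat a.2))
              (2 * 2) (T c))
    {ψ : ℂ} (hψ : ψ ^ 6 ≠ 1) (σ : Equiv.Perm (Fin 6))
    (w : complexBetti (DworkSextic.fibre ψ) (2 * 2)) (hrat : IsRationalClass w)
    (huv : ∃ u v : complexBetti (DworkSextic.fibre ψ) (2 * 2),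
      DworkSextic.IsEig ψ (fun l => DworkSextic.flatTypes 0 (σ l)) u ∧
      DworkSextic.IsEig ψ (fun l => 6 - DworkSextic.flatTypes 0 (σ l)) v ∧ w = u + v) :
    w ∈ Submodule.span ℂ {c : complexBetti (DworkSextic.fibre ψ) (2 * 2) | IsRationalClass c ∧
      IsOfHodgeType 4 (DworkSextic.fibre ψ) (2 * 2) 2 2 c ∧ ∃ i i' : Fin 6, i ≠ i' ∧ ∃ ζ : ℂ, ζ ^ 6 = 1 ∧
        ∃ g : C(ComplexPoints (DworkSextic.fibre ψ), ComplexPoints (DworkSextic.fibre ψ)),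
          (∀ x, ∃ t : ℂ, (DworkSextic.pt ψ (g x)).rep = t • (fun k => if k = i then ζ * (DworkSextic.pt ψ x).rep i'
            else if k = i' then ζ⁻¹ * (DworkSextic.pt ψ x).rep i else (DworkSextic.pt ψ x).rep k)) ∧
          singularCohomology.map ℂ ℂ g (2 * 2) c = c} := by
  obtain ⟨T, hTinj, hTeq⟩ := hT ψ hψ
  exact DworkSextic.flatClasses_mem_span_reflInvariant_singleton_of_rank_le_one hψ σ
    (DworkSextic.singleton_rank_le_one_of_equivariant_transport T hTinj hTeq) w hrat huv

end Summit.HodgeConjecture.HodgeConjecture.Theorems
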